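import Mathlib.RingTheory.MvPolynomial.Homogeneous
import Mathlib.Algebra.MonoidAlgebra.MapDomain
import Mathlib.Algebra.MonoidAlgebra.Module
import Mathlib.Algebra.MonoidAlgebra.Grading
import Literature.Algebra.Homology.OrderedCech
import HarnessLib

/-!
# The Čech complex of a graded module over `A[x₀, …, x_r]` inside Laurent polynomials

For a commutative ring `A` let `P = A[x₀, …, x_r]` and `L = A[x₀^{±1}, …, x_r^{±1}]` (realised as the
additive monoid algebra of `ℤ^{r+1}`, `LaurentCech.L`, with `P ↪ L`, `LaurentCech.toL`). For an
index type `J` (arbitrary here; downstream `J` is finite, when the product `P^J = J → P` is the free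
graded module `F_e = ⊕_j P(-e_j)`), a shift `e : J → ℤ` and a `P`-submodule `K ⊆ P^J`, this file
defines, with Mathlib primitives only:

* `LaurentCech.Ldeg A r c` — the degree-`c` part of `L` (`A`-span of the Laurent monomials `x^m`,
  `|m| = c`; an `abbrev` for Mathlib's `AddMonoidAlgebra.gradeBy A (edeg r) c`);
  `LaurentCech.Kdeg A r e d` — the degree-`d` part of `L^J` for the shifted grading (`v_j ∈ L_{d - e_j}`);
* `LaurentCech.xs A s N = x_s^N = Π_{i ∈ s} x_i^N ∈ L` (`N ∈ ℤ`) for a set `s` of variables, and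
  `LaurentCech.Xs A s = Π_{i ∈ s} x_i ∈ P`;
* `LaurentCech.loc K s ⊆ L^J` — **the localization `K_{X_s} = K[1/X_s]` realised inside `L^J`**: the
  vectors `v` with `x_s^N v ∈ ι(K)` for some `N ≥ 0` (`ι = LaurentCech.ιK : P^J ↪ L^J`); it is an
  `A`-submodule, stable under `P` and `x_s^{±1}`, and MONOTONE in `s` (`loc_mono`), which is what makes
  the restriction maps of the Čech complex inclusions;
* `LaurentCech.locDeg e K s d = K_s ∩ (L^J)_d` and
  **`LaurentCech.cech e K d`, the degree-`d` Čech complex `Č_d(K)` of `K` with respect to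
  `x₀, …, x_r`**: the ordered Čech complex (`Literature.Algebra.Homology.OrderedCech.complex`,
  Görtz–Wedhorn II, Def. 21.68) of the monotone family `s ↦ (K_s)_d` — in degree `p` the product over
  `i₀ < ⋯ < i_p` of `(K_{x_{i₀}⋯x_{i_p}})_d` with the alternating-sum differential.

For `K = 𝔞` a homogeneous ideal (`J = pt`) and `Z = V₊(𝔞) ⊆ 𝐏^r_A`, `Č_0(P)/Č_0(𝔞)` is the Čech
complex of `𝒪_Z` for the standard affine cover `Z ∩ D₊(x_i)` (Hartshorne III.5, proof of Thm. 5.1: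
"`Γ(U_{i₀…i_p}, 𝒪(n)) = S(n)_{(x_{i₀}⋯x_{i_p})}`, the degree-`n` part of `S_{x_{i₀}⋯x_{i_p}}`";
Stacks Project, Tag 01XT), which is how the sibling files use it: `LaurentCechFree` /
`LaurentCechFreeCohomology` compute the cohomology of `Č_d(F_e)` explicitly (Serre's computation of
`H^i(𝐏^r, 𝒪(n))`, Hartshorne III Thm. 5.1), and `LaurentCechExact` / `SerreFiniteness` prove that
`H^i(Č_d(K))` is a finitely generated `A`-module for `A` Noetherian, `K` graded and `i ≥ 1`
(Hartshorne III Thm. 5.2 (a)). This file only sets up the objects; everything is proved, no facts.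

Design notes. Working inside the one ambient module `L^J` (all `x_i` are units of `L`) turns
localization maps into inclusions and lets us reuse `OrderedCech`; degrees are integers throughout
(`Ldeg`, `Kdeg` are indexed by `ℤ`, polynomials have no negative-degree part). Mathlib searched
(pin v4.32): `AddMonoidAlgebra` (now a one-field structure with `coeff`), `AddMonoidAlgebra.gradeBy`
(used for `Ldeg`, with `mem_gradeBy_iff`, `single_mem_gradeBy`, `SetLike.mul_mem_graded`),
`MvPolynomial.IsHomogeneous`, `homogeneousSubmodule`, `HomogeneousLocalization` (degree-zero
localization of a graded ALGEBRA only — no graded modules, no Čech complexes of graded modules, no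
cohomology of projective space). Related in the tree: `castExp`/`toL` are the general-`A` versions of
the `ℂ`-specific `expCast`/`toLaurent` of `Literature/NumberTheory/Automorphic/SymmLaurentWeylInvariants`
(a librarian may retarget that copy; importing it here would be the wrong dependency direction).

## References

* R. Hartshorne, *Algebraic Geometry*, GTM 52, Springer (1977): III.5, proof of Thm. 5.1
  (pp. 225–227). [Hartshorne1977]
* The Stacks Project, Tag 01XT (Cohomology of Schemes, Section 30.8, cohomology of projective
  space), Tag 01FG (ordered Čech complex). [StacksProject]
* U. Görtz, T. Wedhorn, *Algebraic Geometry II*, Springer Spektrum (2023): Def. 21.68 (p. 260),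
  §22.6 (cohomology of projective space via the Čech complex of the standard cover). [GortzWedhorn2023]
-/

noncomputable section

open Finset AddMonoidAlgebra

universe u

namespace Literature.Algebra.Homology

namespace LaurentCech

variable (A : Type u) [CommRing A] (r : ℕ)

/-! ### Exponent vectors, Laurent polynomials and their degree parts -/

/-- Exponent vectors of Laurent monomials in `x₀, …, x_r`: functions `Fin (r+1) → ℤ`. [folklore] -/
abbrev Expt (r : ℕ) : Type := Fin (r + 1) → ℤ

/-- The total degree `|m| = Σ_i m_i` of an exponent vector, an additive homomorphism. [folklore] -/
def edeg : Expt r →+ ℤ := ∑ i : Fin (r + 1), Pi.evalAddMonoidHom (fun _ => ℤ) i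

/-- `edeg m = Σ_i m_i`. [folklore] -/
theorem edeg_apply (m : Expt r) : edeg r m = ∑ i, m i := by
  simp [edeg]

/-- The ring of Laurent polynomials `L = A[x₀^{±1}, …, x_r^{±1}]`, as the additive monoid algebra of
`ℤ^{r+1}` over `A`. [folklore] -/
abbrev L : Type u := AddMonoidAlgebra A (Expt r)

/-- The degree-`c` part `L_c` of the Laurent polynomial ring: Laurent polynomials all of whose
monomials `x^m` have total degree `|m| = c` — Mathlib's grading `AddMonoidAlgebra.gradeBy` of the
monoid algebra by the degree homomorphism `edeg` (an `abbrev`, so that Mathlib's graded-algebra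
instances `AddMonoidAlgebra.gradeBy.gradedMonoid/gradedAlgebra` apply verbatim). [folklore] -/
abbrev Ldeg (c : ℤ) : Submodule A (L A r) :=
  AddMonoidAlgebra.gradeBy A (edeg r) c

variable {A r}

/-- Membership in `L_c`: every monomial in the support has total degree `c` (Mathlib
`AddMonoidAlgebra.mem_gradeBy_iff`, pointwise). [folklore] -/
theorem mem_Ldeg {c : ℤ} {x : L A r} : x ∈ Ldeg A r c ↔ ∀ m, x.coeff m ≠ 0 → edeg r m = c := by
  change (∀ m, m ∈ x.coeff.support → edeg r m = c) ↔ _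
  simp only [Finsupp.mem_support_iff]

/-- A monomial of degree `c` lies in `L_c` (Mathlib `AddMonoidAlgebra.single_mem_gradeBy`). [folklore] -/
theorem single_mem_Ldeg {c : ℤ} {m : Expt r} (hm : edeg r m = c) (a : A) :
    AddMonoidAlgebra.single m a ∈ Ldeg A r c :=
  hm ▸ AddMonoidAlgebra.single_mem_gradeBy _ m a

/-- Coefficients of a product with a monomial: `(x^m · a · y)_{m'} = a · y_{m' - m}`. [folklore] -/
theorem coeff_single_mul (m m' : Expt r) (a : A) (y : L A r) :
    (AddMonoidAlgebra.single m a * y).coeff m' = a * y.coeff (m' - m) := by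
  rw [AddMonoidAlgebra.coeff_single_mul_apply, neg_add_eq_sub]

/-- `L_c · L_{c'} ⊆ L_{c + c'}` (Mathlib's graded-monoid structure `SetLike.mul_mem_graded` for
`AddMonoidAlgebra.gradeBy`). [folklore] -/
theorem mul_mem_Ldeg {c c' : ℤ} {x y : L A r} (hx : x ∈ Ldeg A r c) (hy : y ∈ Ldeg A r c') :
    x * y ∈ Ldeg A r (c + c') :=
  SetLike.mul_mem_graded hx hy

/-- Multiplication by a monomial of degree `c` maps `L_{c'}` to `L_{c + c'}`. [folklore] -/
theorem single_mul_mem_Ldeg {c c' : ℤ} {m : Expt r} (hm : edeg r m = c) (a : A) {y : L A r}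
    (hy : y ∈ Ldeg A r c') : AddMonoidAlgebra.single m a * y ∈ Ldeg A r (c + c') :=
  mul_mem_Ldeg (single_mem_Ldeg hm a) hy

/-! ### Polynomials inside Laurent polynomials -/

variable (A r)

/-- The polynomial ring `P = A[x₀, …, x_r]`. [folklore] -/
abbrev P : Type u := MvPolynomial (Fin (r + 1)) A

/-- Exponent vectors of monomials are exponent vectors of Laurent monomials (`ℕ^{r+1} ⊆ ℤ^{r+1}`).
[folklore] -/
def castExp : (Fin (r + 1) →₀ ℕ) →+ Expt r where
  toFun m i := (m i : ℤ)
  map_zero' := by ext; simp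
  map_add' m m' := by ext; simp

/-- `castExp m i = m i`. [folklore] -/
@[simp] theorem castExp_apply (m : Fin (r + 1) →₀ ℕ) (i : Fin (r + 1)) : castExp r m i = m i := rfl

/-- `castExp` is injective. [folklore] -/
theorem castExp_injective : Function.Injective (castExp r) := by
  intro m m' h
  ext i
  have := congr_fun h i
  simpa using this

/-- The total degree of `castExp m` is the degree of `m`. [folklore] -/
theorem edeg_castExp (m : Fin (r + 1) →₀ ℕ) : edeg r (castExp r m) = (m.degree : ℤ) := by
  rw [edeg_apply, Finsupp.degree_eq_sum, Nat.cast_sum]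
  rfl

/-- An exponent vector is in the image of `castExp` iff all its entries are non-negative.
[folklore] -/
theorem mem_range_castExp_iff (m : Expt r) : m ∈ Set.range (castExp r) ↔ ∀ i, 0 ≤ m i := by
  constructor
  · rintro ⟨m', rfl⟩ i
    exact Int.natCast_nonneg _
  · intro h
    refine ⟨Finsupp.equivFunOnFinite.symm fun i => (m i).toNat, ?_⟩
    ext i
    simp [h i]

/-- The embedding `A[x₀, …, x_r] ↪ A[x₀^{±1}, …, x_r^{±1}]`, an `A`-algebra homomorphism. [folklore] -/
def toL : P A r →ₐ[A] L A r := AddMonoidAlgebra.mapDomainAlgHom A A (castExp r)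

variable {A r}

/-- `toL p = mapDomain castExp p`. [folklore] -/
theorem toL_apply (p : P A r) : toL A r p = AddMonoidAlgebra.mapDomain (castExp r) p := rfl

/-- `toL` is injective. [folklore] -/
theorem toL_injective : Function.Injective (toL A r) :=
  AddMonoidAlgebra.mapDomain_injective (castExp_injective r)

/-- Coefficients of `toL p` at exponent vectors of monomials. [folklore] -/
@[simp] theorem coeff_toL_castExp (p : P A r) (m : Fin (r + 1) →₀ ℕ) :
    (toL A r p).coeff (castExp r m) = p.coeff m := by
  rw [toL_apply, AddMonoidAlgebra.mapDomain, AddMonoidAlgebra.coeff_ofCoeff,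
    Finsupp.mapDomain_apply (castExp_injective r)]
  rfl

/-- Coefficients of `toL p` vanish at exponent vectors with a negative entry. [folklore] -/
theorem coeff_toL_eq_zero (p : P A r) {m : Expt r} (hm : ∃ i, m i < 0) :
    (toL A r p).coeff m = 0 := by
  rw [toL_apply, AddMonoidAlgebra.mapDomain, AddMonoidAlgebra.coeff_ofCoeff,
    Finsupp.mapDomain_notin_range]
  rw [mem_range_castExp_iff]
  obtain ⟨i, hi⟩ := hm
  exact fun h => (h i).not_gt hi

/-- `toL` of a monomial. [folklore] -/
@[simp] theorem toL_monomial (m : Fin (r + 1) →₀ ℕ) (a : A) :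
    toL A r (MvPolynomial.monomial m a) = AddMonoidAlgebra.single (castExp r m) a := by
  rw [toL_apply, ← MvPolynomial.single_eq_monomial, AddMonoidAlgebra.mapDomain_single]

/-- `toL (x_i)` is the Laurent monomial `x_i`. [folklore] -/
theorem toL_X (i : Fin (r + 1)) :
    toL A r (MvPolynomial.X i) = AddMonoidAlgebra.single (Pi.single i 1) 1 := by
  rw [MvPolynomial.X, toL_monomial]
  congr 1
  ext j
  simp [Pi.single_apply, Finsupp.single_apply, eq_comm]

/-- `weight 1 = degree` on exponent vectors (Mathlib's `Finsupp.degree_eq_weight_one`, pointwise).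
[folklore] -/
theorem weight_one_apply {σ : Type*} (m : σ →₀ ℕ) : Finsupp.weight (1 : σ → ℕ) m = m.degree := by
  rw [Finsupp.degree_eq_weight_one]
  rfl

/-- A polynomial is homogeneous of degree `c` iff its image lies in `L_c`. [folklore] -/
theorem toL_mem_Ldeg_iff (p : P A r) (c : ℕ) : toL A r p ∈ Ldeg A r c ↔ p.IsHomogeneous c := by
  rw [mem_Ldeg]
  constructor
  · intro h m hm
    have := h (castExp r m) (by rwa [coeff_toL_castExp])
    rw [edeg_castExp] at this
    change Finsupp.weight (1 : Fin (r + 1) → ℕ) m = c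
    rw [weight_one_apply]
    exact_mod_cast this
  · intro h m hm
    by_cases hneg : ∃ i, m i < 0
    · exact absurd (coeff_toL_eq_zero p hneg) hm
    · push Not at hneg
      obtain ⟨m', rfl⟩ := (mem_range_castExp_iff r m).mpr hneg
      rw [coeff_toL_castExp] at hm
      rw [edeg_castExp]
      have := h hm
      change Finsupp.weight (1 : Fin (r + 1) → ℕ) m' = c at this
      rw [weight_one_apply] at this
      exact_mod_cast this

/-! ### The Laurent monomials `x_s^N` of a set of variables -/

variable (r) in
/-- The exponent vector `N · 𝟙_s` of the Laurent monomial `x_s^N = Π_{i ∈ s} x_i^N` (`N ∈ ℤ`).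
[folklore] -/
def sx (s : Finset (Fin (r + 1))) (N : ℤ) : Expt r := fun i => if i ∈ s then N else 0

/-- `sx s N i = N` for `i ∈ s` and `0` otherwise. [folklore] -/
theorem sx_apply (s : Finset (Fin (r + 1))) (N : ℤ) (i : Fin (r + 1)) :
    sx r s N i = if i ∈ s then N else 0 := rfl

/-- `sx s` is additive in the exponent. [folklore] -/
theorem sx_add (s : Finset (Fin (r + 1))) (N N' : ℤ) : sx r s (N + N') = sx r s N + sx r s N' := by
  ext i; simp only [sx_apply, Pi.add_apply]; split_ifs <;> simp

/-- `sx s 0 = 0`. [folklore] -/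
@[simp] theorem sx_zero (s : Finset (Fin (r + 1))) : sx r s 0 = 0 := by
  ext i; simp [sx_apply]

/-- `sx s (-N) = - sx s N`. [folklore] -/
theorem sx_neg (s : Finset (Fin (r + 1))) (N : ℤ) : sx r s (-N) = -sx r s N := by
  ext i; simp only [sx_apply, Pi.neg_apply]; split_ifs <;> simp

/-- For `s ⊆ t`, `sx t N = sx (t \ s) N + sx s N`. [folklore] -/
theorem sx_eq_sdiff_add {s t : Finset (Fin (r + 1))} (h : s ⊆ t) (N : ℤ) :
    sx r t N = sx r (t \ s) N + sx r s N := by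
  ext i
  simp only [sx_apply, Pi.add_apply, Finset.mem_sdiff]
  by_cases hi : i ∈ s
  · simp [hi, h hi]
  · by_cases ht : i ∈ t <;> simp [hi, ht]

/-- The total degree of `sx s N` is `N · #s`. [folklore] -/
theorem edeg_sx (s : Finset (Fin (r + 1))) (N : ℤ) : edeg r (sx r s N) = N * s.card := by
  rw [edeg_apply]
  simp only [sx_apply]
  rw [Finset.sum_ite_mem, Finset.univ_inter, Finset.sum_const, nsmul_eq_mul, mul_comm]

variable (A) in
/-- The Laurent monomial `x_s^N = Π_{i ∈ s} x_i^N ∈ L` (`N ∈ ℤ`). [folklore] -/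
def xs (s : Finset (Fin (r + 1))) (N : ℤ) : L A r := AddMonoidAlgebra.single (sx r s N) 1

/-- `x_s^{N + N'} = x_s^N x_s^{N'}`. [folklore] -/
theorem xs_add (s : Finset (Fin (r + 1))) (N N' : ℤ) : xs A s (N + N') = xs A s N * xs A s N' := by
  rw [xs, xs, xs, AddMonoidAlgebra.single_mul_single, sx_add, mul_one]

/-- `x_s^0 = 1`. [folklore] -/
@[simp] theorem xs_zero (s : Finset (Fin (r + 1))) : xs A s 0 = 1 := by
  rw [xs, sx_zero]; rfl

/-- `x_s^N x_s^{-N} = 1`. [folklore] -/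
theorem xs_mul_xs_neg (s : Finset (Fin (r + 1))) (N : ℤ) : xs A s N * xs A s (-N) = 1 := by
  rw [← xs_add, add_neg_cancel, xs_zero]

/-- `x_s^{-N} x_s^{N} = 1`. [folklore] -/
theorem xs_neg_mul_xs (s : Finset (Fin (r + 1))) (N : ℤ) : xs A s (-N) * xs A s N = 1 := by
  rw [← xs_add, neg_add_cancel, xs_zero]

/-- For `s ⊆ t`, `x_t^N = x_{t ∖ s}^N x_s^N`. [folklore] -/
theorem xs_eq_sdiff_mul {s t : Finset (Fin (r + 1))} (h : s ⊆ t) (N : ℤ) :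
    xs A t N = xs A (t \ s) N * xs A s N := by
  rw [xs, xs, xs, AddMonoidAlgebra.single_mul_single, ← sx_eq_sdiff_add h, mul_one]

/-- `x_s^N ∈ L_{N · #s}`. [folklore] -/
theorem xs_mem_Ldeg (s : Finset (Fin (r + 1))) (N : ℤ) : xs A s N ∈ Ldeg A r (N * s.card) :=
  single_mem_Ldeg (edeg_sx s N) 1

variable (A) in
/-- The monomial `X_s = Π_{i ∈ s} x_i ∈ P`. [folklore] -/
def Xs (s : Finset (Fin (r + 1))) : P A r := ∏ i ∈ s, MvPolynomial.X i

/-- `toL (X_s^N) = x_s^N` for `N ∈ ℕ`. [folklore] -/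
theorem toL_Xs_pow (s : Finset (Fin (r + 1))) (N : ℕ) : toL A r (Xs A s ^ N) = xs A s N := by
  rw [map_pow, Xs, map_prod]
  simp_rw [toL_X]
  rw [AddMonoidAlgebra.prod_single, Finset.prod_const_one, AddMonoidAlgebra.single_pow, one_pow, xs]
  congr 1
  ext i
  simp only [sx_apply, Pi.smul_apply, Finset.sum_apply, Pi.single_apply]
  rw [Finset.sum_ite_eq]
  split_ifs <;> simp

/-! ### Free graded modules inside `L^n` and the localized pieces of a submodule -/

variable {J : Type} (e : J → ℤ)

variable (A r) in
/-- The degree-`d` part of `𝕂 = L^n` for the grading shifted by `e`: `v ∈ 𝕂_d` iff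
`v_j ∈ L_{d - e_j}` for all `j` (the basis vector `e_j` sits in degree `e_j`). [folklore] -/
def Kdeg (d : ℤ) : Submodule A (J → L A r) :=
  Submodule.pi Set.univ fun j => Ldeg A r (d - e j)

/-- Membership in `𝕂_d`. [folklore] -/
theorem mem_Kdeg {d : ℤ} {v : J → L A r} : v ∈ Kdeg A r e d ↔ ∀ j, v j ∈ Ldeg A r (d - e j) := by
  simp [Kdeg, Submodule.mem_pi]

/-- Multiplication by `x_s^N` maps `𝕂_d` to `𝕂_{d + N #s}`. [folklore] -/
theorem xs_smul_mem_Kdeg {d : ℤ} {v : J → L A r} (hv : v ∈ Kdeg A r e d)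
    (s : Finset (Fin (r + 1))) (N : ℤ) : xs A s N • v ∈ Kdeg A r e (d + N * s.card) := by
  rw [mem_Kdeg] at hv ⊢
  intro j
  rw [Pi.smul_apply, smul_eq_mul, show d + N * s.card - e j = N * s.card + (d - e j) by ring]
  exact mul_mem_Ldeg (xs_mem_Ldeg s N) (hv j)

variable (A r J) in
/-- The embedding `ι : P^n ↪ L^n`, coordinatewise `toL`, an `A`-linear map. [folklore] -/
def ιK : (J → P A r) →ₗ[A] (J → L A r) := (toL A r).toLinearMap.compLeft J

/-- `ι v j = toL (v j)`. [folklore] -/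
@[simp] theorem ιK_apply (v : J → P A r) (j : J) : ιK A r J v j = toL A r (v j) := rfl

/-- `ι` is injective. [folklore] -/
theorem ιK_injective : Function.Injective (ιK A r J) := fun _ _ h =>
  funext fun j => toL_injective (congr_fun h j)

/-- `ι` is `P`-semilinear: `ι (p • v) = toL p • ι v`. [folklore] -/
theorem ιK_smul (p : P A r) (v : J → P A r) : ιK A r J (p • v) = toL A r p • ιK A r J v := by
  ext j : 1
  simp [Pi.smul_apply, smul_eq_mul, map_mul]

/-- `x_s^N · ι v = ι (X_s^N · v)` for `N ∈ ℕ`. [folklore] -/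
theorem xs_smul_ιK (s : Finset (Fin (r + 1))) (N : ℕ) (v : J → P A r) :
    xs A s N • ιK A r J v = ιK A r J (Xs A s ^ N • v) := by
  rw [ιK_smul, toL_Xs_pow]

variable (K : Submodule (P A r) (J → P A r))

/-- **The localized piece `K_s ⊆ L^n` of a `P`-submodule `K ⊆ P^n` at the monomial `X_s`**:
the vectors `v ∈ L^n` with `x_s^N v ∈ ι(K)` for some `N ≥ 0` — the image of the localization
`K_{X_s} = K ⊗_P P[1/X_s]` inside `L^n` (all `x_i` are units of `L`). [folklore] -/
def loc (s : Finset (Fin (r + 1))) : Submodule A (J → L A r) where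
  carrier := {v | ∃ (N : ℕ) (k : J → P A r), k ∈ K ∧ xs A s N • v = ιK A r J k}
  zero_mem' := ⟨0, 0, K.zero_mem, by simp⟩
  add_mem' := by
    rintro _ _ ⟨N, k, hk, hv⟩ ⟨N', k', hk', hw⟩
    refine ⟨N + N', Xs A s ^ N' • k + Xs A s ^ N • k', K.add_mem (K.smul_mem _ hk) (K.smul_mem _ hk'),
      ?_⟩
    rw [smul_add, map_add, ← xs_smul_ιK, ← xs_smul_ιK, ← hv, ← hw, smul_smul, smul_smul, ← xs_add,
      ← xs_add, Nat.cast_add, add_comm (N' : ℤ)]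
  smul_mem' := by
    rintro a v ⟨N, k, hk, hv⟩
    refine ⟨N, a • k, Submodule.smul_of_tower_mem K a hk, ?_⟩
    rw [smul_comm, hv, map_smul]

/-- Membership in `K_s`. [folklore] -/
theorem mem_loc {s : Finset (Fin (r + 1))} {v : J → L A r} :
    v ∈ loc K s ↔ ∃ (N : ℕ) (k : J → P A r), k ∈ K ∧ xs A s N • v = ιK A r J k := Iff.rfl

/-- The witness exponent in `K_s` may be enlarged. [folklore] -/
theorem exists_of_mem_loc {s : Finset (Fin (r + 1))} {v : J → L A r} (hv : v ∈ loc K s)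
    (N₀ : ℕ) : ∃ (N : ℕ) (k : J → P A r), N₀ ≤ N ∧ k ∈ K ∧ xs A s N • v = ιK A r J k := by
  obtain ⟨N, k, hk, hv⟩ := hv
  refine ⟨N + N₀, Xs A s ^ N₀ • k, Nat.le_add_left _ _, K.smul_mem _ hk, ?_⟩
  rw [← xs_smul_ιK, ← hv, smul_smul, ← xs_add, Nat.cast_add, add_comm (N : ℤ)]

/-- `ι(K) ⊆ K_s`. [folklore] -/
theorem ιK_mem_loc {s : Finset (Fin (r + 1))} {k : J → P A r} (hk : k ∈ K) :
    ιK A r J k ∈ loc K s :=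
  ⟨0, k, hk, by simp⟩

/-- `K_s` is stable under multiplication by `x_s^N`, `N ∈ ℤ`. [folklore] -/
theorem xs_smul_mem_loc {s : Finset (Fin (r + 1))} {v : J → L A r} (hv : v ∈ loc K s) (N : ℤ) :
    xs A s N • v ∈ loc K s := by
  obtain ⟨M, k, hM, hk, hv⟩ := exists_of_mem_loc K hv N.natAbs
  refine ⟨(M - N).toNat, k, hk, ?_⟩
  rw [smul_smul, ← xs_add, ← hv]
  have hNM : N ≤ (M : ℤ) := le_trans Int.le_natAbs (by exact_mod_cast hM)
  congr 2
  omega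

/-- `K_s` is stable under multiplication by polynomials. [folklore] -/
theorem toL_smul_mem_loc {s : Finset (Fin (r + 1))} {v : J → L A r} (hv : v ∈ loc K s)
    (p : P A r) : toL A r p • v ∈ loc K s := by
  obtain ⟨N, k, hk, hv⟩ := hv
  refine ⟨N, p • k, K.smul_mem p hk, ?_⟩
  rw [smul_comm, hv, ιK_smul]

/-- **`s ↦ K_s` is monotone**: for `s ⊆ t`, `K_s ⊆ K_t` (`x_t^N = x_{t∖s}^N x_s^N`). [folklore] -/
theorem loc_mono : Monotone (loc K) := by
  intro s t hst v ⟨N, k, hk, hv⟩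
  refine ⟨N, Xs A (t \ s) ^ N • k, K.smul_mem _ hk, ?_⟩
  rw [xs_eq_sdiff_mul hst, mul_smul, hv, xs_smul_ιK]

/-- The degree-`d` part `(K_s)_d = K_s ∩ 𝕂_d` of the localized piece. [folklore] -/
def locDeg (s : Finset (Fin (r + 1))) (d : ℤ) : Submodule A (J → L A r) :=
  loc K s ⊓ Kdeg A r e d

/-- Membership in `(K_s)_d`. [folklore] -/
theorem mem_locDeg {s : Finset (Fin (r + 1))} {d : ℤ} {v : J → L A r} :
    v ∈ locDeg e K s d ↔ v ∈ loc K s ∧ v ∈ Kdeg A r e d := Iff.rfl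

/-- `s ↦ (K_s)_d` is monotone. [folklore] -/
theorem locDeg_mono (d : ℤ) : Monotone fun s => locDeg e K s d :=
  fun _ _ hst => inf_le_inf_right _ (loc_mono K hst)

/-- **The degree-`d` Čech complex `Č_d(K)` of the graded submodule `K ⊆ P^n`** with respect to
`x₀, …, x_r`: the ordered Čech complex (`OrderedCech.complex`) of the monotone family
`s ↦ (K_s)_d` of `A`-submodules of `L^n` — in degree `p` the product over the `p`-simplices
`s = {i₀ < ⋯ < i_p}` of `(K_{x_{i₀} ⋯ x_{i_p}})_d`, with the alternating-sum differential. For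
`K = P/𝔞`-presentations this computes the Čech cohomology of the twists of the associated sheaf on
`Proj`, cf. the sibling files. [folklore] -/
def cech (d : ℤ) : CochainComplex (ModuleCat.{u} A) ℤ :=
  OrderedCech.complex (fun s => locDeg e K s d) (locDeg_mono e K d)

end LaurentCech

end Literature.Algebra.Homology
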